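import Summits.ResolutionOfSingularities.ResolutionOfSingularities.Theorems.HilbertSamuelEliminationSigmaMaxModificationsCorridor3TameWildDefs
import Summits.ResolutionOfSingularities.ResolutionOfSingularities.Theorems.HilbertSamuelEliminationSigmaMaxModificationsCorridor3NuGluingMerge
import Literature.AlgebraicGeometry.Resolution.HilbertSamuelLocal
import Literature.AlgebraicGeometry.Resolution.ResolutionGlue
import Mathlib.AlgebraicGeometry.Morphisms.Proper
import HarnessLib

/-!
# Route `HilbertSamuelElimination`, crux `SigmaMaxModificationsCorridor3`
# (stmt-ResolutionOfSingularities-19249; child of `SigmaMaxModifications` stmt-…-18506),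
# line `tame_wild` v3 (confined form) — `ν`-GLUING OF FINITELY MANY LOCAL WITNESSES: the passage to `NuMod`

[OURS · L1 W4.2] Companion of `…Corridor3NuGluingMerge.lean` (the shape-preserving two-chart merge
`exists_localWitness_sup`, structure-map form of local `ν`-witnesses). Here:

* `localWitness_compl` — the identity of `Zc = X ∖ X(ν)` is a witness over `Zc`;
* `nuMod_of_localWitness_top` — a witness over all of `X` is a `ν`-modification (`NuMod X N d ν`:
  CJS Def. 6.14 in modification form);
* `nuMod_of_localWitness'` — ONE witness over `U₁` with `Zc ∪ U₁ = X` gives a `ν`-modification (the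
  landed `nuMod_of_localWitness`, p459350, in structure-map form, now a corollary of the merge);
* `nuMod_of_two_localWitnesses` — TWO witnesses with disjoint traces (`U₁ ∩ U₂ ⊆ Zc`) covering
  `X(ν)` give a `ν`-modification (plan-1's ν-gluing v2 `stub_G2_nuMod_of_two_localWitnesses` in
  structure-map form). Finitely many witnesses: iterate the merge, then `nuMod_of_localWitness'`.

NOT a statement of any manuscript.

## Sources

* The Stacks Project, Tags 01JA, 01LH. [StacksProject]
* V. Cossart, U. Jannsen, S. Saito, LNM 2270 (2020), Def. 2.28, Def. 6.14, Rem. 6.24.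
  [CossartJannsenSaito2020]
-/

set_option linter.dupNamespace false -- mandated namespace of this single-conjunct summit

noncomputable section

open CategoryTheory CategoryTheory.Limits AlgebraicGeometry TopologicalSpace Topology
open Literature.AlgebraicGeometry.Resolution Literature.RingTheory.HilbertSamuel

namespace Summit.ResolutionOfSingularities.ResolutionOfSingularities.Theorems.SigmaMaxModificationsCorridor3.TameWild

universe u

/-! ## The identity witness and the passage to `NuMod` -/

/-- **The identity of `Zc = X ∖ X(ν)` is a local `ν`-witness over `Zc`** (structure-map form): image
in `Zc`, an isomorphism (hence proper) over `Zc`, reduced of the dimension of `X`, dense opens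
restrict to dense opens, `H^N` unchanged (the Hilbert–Samuel function is local), and `ν` is not a
value on `Zc`. [cite: CossartJannsenSaito2020, Def. 2.28, Def. 6.14] -/
theorem localWitness_compl (X : Scheme.{u}) [IsLocallyNoetherian X] [IsReduced X] (N d : ℕ)
    (ν : ℕ → ℕ) (hdimd : topologicalKrullDim X ≤ (d : WithBot ℕ∞))
    (hdimN : topologicalKrullDim X ≤ (N : WithBot ℕ∞)) (Zc : X.Opens)
    (hZc : (Zc : Set X) = (Scheme.hsStratum X N ν)ᶜ) :
    IsLocallyNoetherian (Zc : Scheme.{u}) ∧ (∀ z : (Zc : Scheme.{u}), Zc.ι z ∈ Zc) ∧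
      (∀ x ∈ Zc, ∃ W : X.Opens, x ∈ W ∧ IsProper (Zc.ι ∣_ W)) ∧ IsReduced (Zc : Scheme.{u}) ∧
      topologicalKrullDim (Zc : Scheme.{u}) ≤ (d : WithBot ℕ∞) ∧
      topologicalKrullDim (Zc : Scheme.{u}) ≤ (N : WithBot ℕ∞) ∧
      IsIso (Zc.ι ∣_ (Zc ⊓ Zc)) ∧
      (∀ V : X.Opens, Dense (V : Set X) → (V : Set X) ⊆ (Scheme.hsStratum X N ν)ᶜ →
        Dense ((Zc.ι ⁻¹ᵁ V : (Zc : Scheme.{u}).Opens) : Set (Zc : Scheme.{u}))) ∧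
      (∀ z : (Zc : Scheme.{u}), Scheme.hsFun (Zc : Scheme.{u}) N z ≤ Scheme.hsFun X N (Zc.ι z)) ∧
      ν ∉ Scheme.hsValues (Zc : Scheme.{u}) N := by
  -- `Zc.ι ∣ Zc` is a surjective open immersion, i.e. an isomorphism
  have hsurj : Function.Surjective (Zc.ι ∣_ Zc).base := by
    rintro ⟨x, hx⟩
    refine ⟨⟨⟨x, hx⟩, hx⟩, Subtype.ext ?_⟩
    rw [morphismRestrict_base_coe]
    rfl
  haveI : Epi (Zc.ι ∣_ Zc).base := (TopCat.epi_iff_surjective _).mpr hsurj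
  have hI : IsIso (Zc.ι ∣_ Zc) := IsOpenImmersion.isIso _
  refine ⟨inferInstance, fun z => z.2, fun x hx => ⟨Zc, hx, ?_⟩, inferInstance,
    (topologicalKrullDim_subspace_le X (Zc : Set X)).trans hdimd,
    (topologicalKrullDim_subspace_le X (Zc : Set X)).trans hdimN,
    isIso_morphismRestrict_of_le Zc.ι hI inf_le_left, fun V hVd _ => ?_, fun z => ?_, ?_⟩
  · haveI := hI
    infer_instance
  · exact hVd.preimage Zc.2.isOpenMap_subtype_val
  · rw [Scheme.hsFun_opens]
  · rintro ⟨z, hz⟩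
    have hz' : z.1 ∈ (Zc : Set X) := z.2
    rw [hZc] at hz'
    apply hz'
    rw [Scheme.mem_hsStratum_iff, ← hz, Scheme.hsFun_opens]
    rfl

/-- **A local `ν`-witness over all of `X` is a `ν`-modification** (structure-map form): properness
is Zariski-local on the target, and an isomorphism over `Zc = X ∖ X(ν)` restricts to an isomorphism
over every open inside `X ∖ X(ν)`. [cite: CossartJannsenSaito2020, Def. 6.14, Rem. 6.24] -/
theorem nuMod_of_localWitness_top (X : Scheme.{0}) (N d : ℕ) (ν : ℕ → ℕ) (Zc : X.Opens)
    (hZc : (Zc : Set X) = (Scheme.hsStratum X N ν)ᶜ) (Y : Scheme.{0}) (a : Y ⟶ X)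
    (hp : ∀ x : X, ∃ W : X.Opens, x ∈ W ∧ IsProper (a ∣_ W)) (hred : IsReduced Y)
    (hd : topologicalKrullDim Y ≤ (d : WithBot ℕ∞)) (hN : topologicalKrullDim Y ≤ (N : WithBot ℕ∞))
    (hiso : IsIso (a ∣_ Zc))
    (hdense : ∀ V : X.Opens, Dense (V : Set X) → (V : Set X) ⊆ (Scheme.hsStratum X N ν)ᶜ →
      Dense ((a ⁻¹ᵁ V : Y.Opens) : Set Y))
    (hmono : ∀ y : Y, Scheme.hsFun Y N y ≤ Scheme.hsFun X N (a y))
    (hkill : ν ∉ Scheme.hsValues Y N) : NuMod X N d ν := by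
  have hP : IsProper a :=
    IsZariskiLocalAtTarget.of_forall_exists_morphismRestrict (P := @IsProper) hp
  refine ⟨Y, a, hP, hred, hd, hN, fun U hU => ?_, hdense, hmono, hkill⟩
  refine isIso_morphismRestrict_of_le a hiso fun x hx => ?_
  have hx' : x ∈ (Scheme.hsStratum X N ν)ᶜ := hU hx
  rw [← hZc] at hx'
  exact hx'

/-- **ONE local `ν`-witness over an open `U₁ ⊇ X(ν)` glues with the identity to a
`ν`-modification** — the landed `nuMod_of_localWitness` (p459350) in structure-map form, now a
corollary of the two-chart merge: merge the witness with the identity witness of `Zc` (their traces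
are trivially disjoint, `U₁ ∩ Zc ⊆ Zc`) and observe `U₁ ∪ Zc = X`.
[cite: StacksProject, Tag 01LH] [cite: CossartJannsenSaito2020, Def. 6.14, Rem. 6.24] -/
theorem nuMod_of_localWitness' (X : Scheme.{0}) [IsLocallyNoetherian X] [IsReduced X] (N d : ℕ)
    (ν : ℕ → ℕ) (hdimd : topologicalKrullDim X ≤ (d : WithBot ℕ∞))
    (hdimN : topologicalKrullDim X ≤ (N : WithBot ℕ∞)) (Zc U₁ : X.Opens)
    (hZc : (Zc : Set X) = (Scheme.hsStratum X N ν)ᶜ) (hcov : Zc ⊔ U₁ = ⊤)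
    (Y₁ : Scheme.{0}) (a₁ : Y₁ ⟶ X) (hn₁ : IsLocallyNoetherian Y₁) (hr₁ : ∀ y, a₁ y ∈ U₁)
    (hp₁ : IsProper (a₁ ∣_ U₁)) (hred₁ : IsReduced Y₁)
    (hd₁ : topologicalKrullDim Y₁ ≤ (d : WithBot ℕ∞)) (hN₁ : topologicalKrullDim Y₁ ≤ (N : WithBot ℕ∞))
    (hiso₁ : IsIso (a₁ ∣_ (U₁ ⊓ Zc)))
    (hdense₁ : ∀ V : X.Opens, Dense (V : Set X) → (V : Set X) ⊆ (Scheme.hsStratum X N ν)ᶜ →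
      Dense ((a₁ ⁻¹ᵁ V : Y₁.Opens) : Set Y₁))
    (hmono₁ : ∀ y : Y₁, Scheme.hsFun Y₁ N y ≤ Scheme.hsFun X N (a₁ y))
    (hkill₁ : ν ∉ Scheme.hsValues Y₁ N) : NuMod X N d ν := by
  obtain ⟨hn₂, hr₂, hp₂, hred₂, hd₂, hN₂, hiso₂, hdense₂, hmono₂, hkill₂⟩ :=
    localWitness_compl X N d ν hdimd hdimN Zc hZc
  obtain ⟨Y, a, -, -, hp, hred, hd, hN, hiso, hdense, hmono, hkill⟩ :=
    exists_localWitness_sup X N d ν Zc U₁ Zc inf_le_right Y₁ a₁ hn₁ hr₁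
      (fun x hx => ⟨U₁, hx, hp₁⟩) hred₁ hd₁ hN₁ hiso₁ hdense₁ hmono₁ hkill₁ (Zc : Scheme.{0}) Zc.ι hn₂
      hr₂ hp₂ hred₂ hd₂ hN₂ hiso₂ hdense₂ hmono₂ hkill₂
  have htop : U₁ ⊔ Zc = ⊤ := by rw [sup_comm]; exact hcov
  refine nuMod_of_localWitness_top X N d ν Zc hZc Y a (fun x => ?_) hred hd hN
    (isIso_morphismRestrict_of_le a hiso (le_inf le_sup_right le_rfl)) hdense hmono hkill
  have hx : x ∈ U₁ ⊔ Zc := by rw [htop]; exact Opens.mem_top x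
  exact hp x hx

/-- **TWO local `ν`-witnesses with disjoint traces covering `X(ν)` glue to a `ν`-modification**
(plan-1's ν-gluing v2, `stub_G2_nuMod_of_two_localWitnesses`, in structure-map form): merge the two
(`U₁ ∩ U₂ ⊆ Zc`), merge with the identity of `Zc`, and `U₁ ∪ U₂ ∪ Zc = X`. Finitely many witnesses
with pairwise disjoint traces: iterate `exists_localWitness_sup`.
[cite: StacksProject, Tag 01LH] [cite: CossartJannsenSaito2020, Def. 6.14, Rem. 6.24] -/
theorem nuMod_of_two_localWitnesses (X : Scheme.{0}) [IsLocallyNoetherian X] [IsReduced X]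
    (N d : ℕ) (ν : ℕ → ℕ) (hdimd : topologicalKrullDim X ≤ (d : WithBot ℕ∞))
    (hdimN : topologicalKrullDim X ≤ (N : WithBot ℕ∞)) (Zc U₁ U₂ : X.Opens)
    (hZc : (Zc : Set X) = (Scheme.hsStratum X N ν)ᶜ) (hcov : Zc ⊔ (U₁ ⊔ U₂) = ⊤)
    (h12 : U₁ ⊓ U₂ ≤ Zc)
    (Y₁ : Scheme.{0}) (a₁ : Y₁ ⟶ X) (hn₁ : IsLocallyNoetherian Y₁) (hr₁ : ∀ y, a₁ y ∈ U₁)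
    (hp₁ : IsProper (a₁ ∣_ U₁)) (hred₁ : IsReduced Y₁)
    (hd₁ : topologicalKrullDim Y₁ ≤ (d : WithBot ℕ∞)) (hN₁ : topologicalKrullDim Y₁ ≤ (N : WithBot ℕ∞))
    (hiso₁ : IsIso (a₁ ∣_ (U₁ ⊓ Zc)))
    (hdense₁ : ∀ V : X.Opens, Dense (V : Set X) → (V : Set X) ⊆ (Scheme.hsStratum X N ν)ᶜ →
      Dense ((a₁ ⁻¹ᵁ V : Y₁.Opens) : Set Y₁))
    (hmono₁ : ∀ y : Y₁, Scheme.hsFun Y₁ N y ≤ Scheme.hsFun X N (a₁ y))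
    (hkill₁ : ν ∉ Scheme.hsValues Y₁ N)
    (Y₂ : Scheme.{0}) (a₂ : Y₂ ⟶ X) (hn₂ : IsLocallyNoetherian Y₂) (hr₂ : ∀ y, a₂ y ∈ U₂)
    (hp₂ : IsProper (a₂ ∣_ U₂)) (hred₂ : IsReduced Y₂)
    (hd₂ : topologicalKrullDim Y₂ ≤ (d : WithBot ℕ∞)) (hN₂ : topologicalKrullDim Y₂ ≤ (N : WithBot ℕ∞))
    (hiso₂ : IsIso (a₂ ∣_ (U₂ ⊓ Zc)))
    (hdense₂ : ∀ V : X.Opens, Dense (V : Set X) → (V : Set X) ⊆ (Scheme.hsStratum X N ν)ᶜ →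
      Dense ((a₂ ⁻¹ᵁ V : Y₂.Opens) : Set Y₂))
    (hmono₂ : ∀ y : Y₂, Scheme.hsFun Y₂ N y ≤ Scheme.hsFun X N (a₂ y))
    (hkill₂ : ν ∉ Scheme.hsValues Y₂ N) : NuMod X N d ν := by
  -- merge the two witnesses over `U₁ ∪ U₂`
  obtain ⟨Y, a, hn, hr, hp, hred, hd, hN, hiso, hdense, hmono, hkill⟩ :=
    exists_localWitness_sup X N d ν Zc U₁ U₂ h12 Y₁ a₁ hn₁ hr₁ (fun x hx => ⟨U₁, hx, hp₁⟩) hred₁ hd₁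
      hN₁ hiso₁ hdense₁ hmono₁ hkill₁ Y₂ a₂ hn₂ hr₂ (fun x hx => ⟨U₂, hx, hp₂⟩) hred₂ hd₂ hN₂ hiso₂
      hdense₂ hmono₂ hkill₂
  -- merge with the identity of `Zc`
  obtain ⟨hn₃, hr₃, hp₃, hred₃, hd₃, hN₃, hiso₃, hdense₃, hmono₃, hkill₃⟩ :=
    localWitness_compl X N d ν hdimd hdimN Zc hZc
  obtain ⟨Y', a', -, -, hp', hred', hd', hN', hiso', hdense', hmono', hkill'⟩ :=
    exists_localWitness_sup X N d ν Zc (U₁ ⊔ U₂) Zc inf_le_right Y a hn hr hp hred hd hN hiso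
      hdense hmono hkill (Zc : Scheme.{0}) Zc.ι hn₃ hr₃ hp₃ hred₃ hd₃ hN₃ hiso₃ hdense₃ hmono₃ hkill₃
  have htop : (U₁ ⊔ U₂) ⊔ Zc = ⊤ := by rw [sup_comm]; exact hcov
  refine nuMod_of_localWitness_top X N d ν Zc hZc Y' a' (fun x => ?_) hred' hd' hN'
    (isIso_morphismRestrict_of_le a' hiso' (le_inf le_sup_right le_rfl)) hdense' hmono' hkill'
  have hx : x ∈ (U₁ ⊔ U₂) ⊔ Zc := by rw [htop]; exact Opens.mem_top x
  exact hp' x hx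

end Summit.ResolutionOfSingularities.ResolutionOfSingularities.Theorems.SigmaMaxModificationsCorridor3.TameWild

end
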